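import Summits.Ventures.PercRepro.S1FiveCircuitX3

/-!
# PercRepro — LEMMA X⁺⁺, part 2: the four-circuit exclusions, counted, and the assembly —
`20·s₅ + 6·C(n−3,2)·s₃ + 16(n−3)·s₃ + (4n − 8)·s₄ ≤ 24·C(n,4)` under (C1), (C2), (C3) (p2, gen 18)

Every four-circuit `D`, point `e ∈ D` and point `x ∉ cl D` (at least `n − 6` of them, `cl D` being a plane) gives the
independent `4`-set `Q = (D ∖ e) ∪ {x}` with `e ∈ excl₂(Q)`, a pair `(Q, e)` arising at most `4` times (`x ∈ Q`
determines `D`). Hence `Σ_{Q indep} #excl₂(Q) ≥ (n − 6)·s₄`, and with the counts of LEMMA X⁺: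
`5·s₅ + (3/2)·C(n−3,2)·s₃ + 4·(s₄ + (n−3)·s₃) + (n−6)·s₄ ≤ 6·C(n,4)`. In the cells it moves the `s₄`-coefficient of the
curve from `16` to `4n − 8`: `(7, 34)`, `(7, 35)`, `(8, 20)` close on block grids.

* `mul_card_le_sum_card_excl2` — `(n − 6)·s₄ ≤ Σ_{Q indep} #excl₂(Q)`;
* **`twenty_mul_ncard_fiveCircuits_add_add_le`** — LEMMA X⁺⁺; **`core_twenty_mul_ncard_fiveCircuits_add_add_le`**.
Axioms: standard.
-/

open scoped Matroid

namespace PercRepro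

namespace S1

open Set

variable {α : Type}

open Classical in
/-- **The four-circuit exclusions, counted**: `(n − 6)·s₄ ≤ Σ_{Q independent} #excl₂(Q)` (under (C2)): every
four-circuit `D`, point `e ∈ D` and point `x ∉ cl D` gives the independent `4`-set `(D ∖ e) ∪ {x}` with `e`
excluded; `cl D` is a plane with `≤ 6` points, and a pair `(Q, e)` arises at most `4` times. -/
theorem mul_card_le_sum_card_excl2 (M : Matroid α) [M.Finite]
    (hC2 : ∀ P ⊆ M.E, M.eRk P ≤ 3 → P.ncard ≤ 6) :
    (M.E.ncard - 6) * (finite_fourCircuits M).toFinset.card ≤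
      ∑ Q ∈ M.ground_finite.toFinset.powersetCard 4,
        (if M.Indep ((Q : Finset α) : Set α) then (excl2 M Q).card else 0) := by
  classical
  set Ef := M.ground_finite.toFinset with hEf
  have hmemE : ∀ x, x ∈ Ef ↔ x ∈ M.E := fun x => Set.Finite.mem_toFinset _
  have hEcard : Ef.card = M.E.ncard := (Set.ncard_eq_toFinset_card _ _).symm
  set F4 := (finite_fourCircuits M).toFinset with hF4
  set Df : Set α → Finset α := fun D => Ef.filter (fun x => x ∈ D) with hDf
  have hDfcoe : ∀ D ∈ F4, ((Df D : Finset α) : Set α) = D := by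
    intro D hD
    rw [hF4, Set.Finite.mem_toFinset] at hD
    ext x
    simp only [hDf, Finset.coe_filter, Set.mem_setOf_eq, hmemE]
    exact ⟨fun h => h.2, fun h => ⟨hD.1.subset_ground h, h⟩⟩
  have hDfcard : ∀ D ∈ F4, (Df D).card = 4 := by
    intro D hD
    have h := hDfcoe D hD
    rw [hF4, Set.Finite.mem_toFinset] at hD
    rw [← Set.ncard_coe_finset, h, hD.2]
  -- the points outside `cl D`: at least `n − 6`
  set Xs : Set α → Finset α := fun D => Ef.filter (fun x => x ∉ M.closure D) with hXs
  have hXscard : ∀ D ∈ F4, M.E.ncard - 6 ≤ (Xs D).card := by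
    intro D hD
    rw [hF4, Set.Finite.mem_toFinset] at hD
    have hDE : D ⊆ M.E := hD.1.subset_ground
    have hDfin : D.Finite := M.ground_finite.subset hDE
    have hrD : M.eRk (M.closure D) ≤ 3 := by
      have hne : M.eRk D ≠ ⊤ := ((M.eRk_le_encard _).trans_lt hDfin.encard_lt_top).ne
      obtain ⟨r, hr⟩ := ENat.ne_top_iff_exists.1 hne
      rw [M.eRk_closure_eq, ← hr]
      have h := hD.1.eRk_add_one_eq
      rw [← hDfin.cast_ncard_eq, hD.2, ← hr] at h
      have h' : r + 1 = 4 := by exact_mod_cast h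
      have h3 : r = 3 := by omega
      rw [h3]
      exact le_of_eq rfl
    have hcl6 : (M.closure D).ncard ≤ 6 := hC2 _ (M.closure_subset_ground D) hrD
    have hin : (Ef.filter (fun x => x ∈ M.closure D)).card ≤ 6 := by
      have hsub : ((Ef.filter (fun x => x ∈ M.closure D) : Finset α) : Set α) ⊆ M.closure D := by
        intro x hx
        rw [Finset.mem_coe, Finset.mem_filter] at hx
        exact hx.2
      have := Set.ncard_le_ncard hsub (M.ground_finite.subset (M.closure_subset_ground D))
      rw [Set.ncard_coe_finset] at this
      omega
    have hsum := Finset.card_filter_add_card_filter_not (s := Ef) (fun x => x ∈ M.closure D)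
    rw [hEcard] at hsum
    simp only [hXs]
    omega
  -- the domain: triples `(D, e, x)`
  set Dom : Finset (Σ _ : Set α, α × α) := F4.sigma (fun D => (Df D) ×ˢ Xs D) with hDom
  have hDomcard : 4 * ((M.E.ncard - 6) * F4.card) ≤ Dom.card := by
    rw [hDom, Finset.card_sigma]
    have h : ∀ D ∈ F4, 4 * (M.E.ncard - 6) ≤ ((Df D) ×ˢ Xs D).card := by
      intro D hD
      rw [Finset.card_product, hDfcard D hD]
      exact Nat.mul_le_mul_left 4 (hXscard D hD)
    have := Finset.sum_le_sum h
    rw [Finset.sum_const, smul_eq_mul] at this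
    calc 4 * ((M.E.ncard - 6) * F4.card) = F4.card * (4 * (M.E.ncard - 6)) := by ring
      _ ≤ _ := this
  -- the map `(D, e, x) ↦ (Q, e)` with `Q = (D ∖ e) ∪ {x}`
  let f : (Σ _ : Set α, α × α) → (Σ _ : Finset α, α) :=
    fun y => ⟨insert y.2.2 ((Df y.1).erase y.2.1), y.2.1⟩
  set P4i := (Ef.powersetCard 4).filter (fun Q => M.Indep ((Q : Finset α) : Set α)) with hP4i
  set Pairs : Finset (Σ _ : Finset α, α) := P4i.sigma (fun Q => excl2 M Q) with hPairs
  have hPairscard : Pairs.card = ∑ Q ∈ Ef.powersetCard 4,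
      (if M.Indep ((Q : Finset α) : Set α) then (excl2 M Q).card else 0) := by
    rw [hPairs, Finset.card_sigma, hP4i, Finset.sum_filter]
  have hDommem : ∀ y ∈ Dom, y.1 ∈ fourCircuits M ∧ y.2.1 ∈ M.E ∧ y.2.1 ∈ y.1 ∧ y.2.2 ∈ M.E ∧
      y.2.2 ∉ M.closure y.1 := by
    intro y hy
    rw [hDom, Finset.mem_sigma, Finset.mem_product] at hy
    obtain ⟨hD, he, hx⟩ := hy
    rw [hF4, Set.Finite.mem_toFinset] at hD
    simp only [hDf, Finset.mem_filter, hmemE] at he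
    simp only [hXs, Finset.mem_filter, hmemE] at hx
    exact ⟨hD, he.1, he.2, hx.1, hx.2⟩
  have himage : Dom.image f ⊆ Pairs := by
    intro b hb
    rw [Finset.mem_image] at hb
    obtain ⟨y, hy, rfl⟩ := hb
    obtain ⟨hD, heE, heD, hxE, hxcl⟩ := hDommem y hy
    have hDF : y.1 ∈ F4 := by rw [hF4, Set.Finite.mem_toFinset]; exact hD
    have hDE : y.1 ⊆ M.E := hD.1.subset_ground
    have hxD : y.2.2 ∉ y.1 := fun h => hxcl (M.subset_closure _ hDE h)
    have heDf : y.2.1 ∈ Df y.1 := by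
      simp only [hDf, Finset.mem_filter, hmemE]
      exact ⟨heE, heD⟩
    have hxDf : y.2.2 ∉ (Df y.1).erase y.2.1 := by
      intro h
      have h' := Finset.mem_of_mem_erase h
      simp only [hDf, Finset.mem_filter] at h'
      exact hxD h'.2
    have hQcard : (insert y.2.2 ((Df y.1).erase y.2.1)).card = 4 := by
      rw [Finset.card_insert_of_notMem hxDf, Finset.card_erase_of_mem heDf, hDfcard _ hDF]
    have hQE : insert y.2.2 ((Df y.1).erase y.2.1) ⊆ Ef :=
      Finset.insert_subset ((hmemE _).2 hxE) ((Finset.erase_subset _ _).trans (Finset.filter_subset _ _))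
    -- the coercion of `Q`
    have hQcoe : ((insert y.2.2 ((Df y.1).erase y.2.1) : Finset α) : Set α) = insert y.2.2 (y.1 \ {y.2.1}) := by
      rw [Finset.coe_insert, Finset.coe_erase, hDfcoe _ hDF]
    -- `Q` is independent: `D ∖ e` is, and `x ∉ cl (D ∖ e)`
    have hind : M.Indep ((insert y.2.2 ((Df y.1).erase y.2.1) : Finset α) : Set α) := by
      rw [hQcoe]
      have hDe : M.Indep (y.1 \ {y.2.1}) :=
        hD.1.ssubset_indep (Set.sdiff_singleton_ssubset.2 heD)
      rw [hDe.insert_indep_iff_of_notMem (fun h => hxD h.1)]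
      refine ⟨hxE, fun h => hxcl (M.closure_subset_closure Set.sdiff_subset h)⟩
    rw [hPairs, Finset.mem_sigma, hP4i, Finset.mem_filter, Finset.mem_powersetCard, mem_excl2]
    refine ⟨⟨⟨hQE, hQcard⟩, hind⟩, heE, ?_, y.1, hD, heD, ?_⟩
    · intro hmem
      rw [Finset.mem_insert] at hmem
      rcases hmem with h | h
      · exact hxD (h ▸ heD)
      · exact (Finset.notMem_erase _ _) h
    · intro z hz
      obtain ⟨hzD, hze⟩ := hz
      rw [hQcoe]
      exact Set.mem_insert_of_mem _ ⟨hzD, hze⟩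
  -- the fibres have at most four elements: `x ∈ Q` determines the triple
  have hfib : ∀ b ∈ Dom.image f, (Dom.filter (fun y => f y = b)).card ≤ 4 := by
    intro b _
    obtain ⟨Q, e⟩ := b
    by_cases hne : (Dom.filter (fun y => f y = ⟨Q, e⟩)).Nonempty
    · obtain ⟨y₀, hy₀⟩ := hne
      rw [Finset.mem_filter] at hy₀
      obtain ⟨hy₀D, hfy₀⟩ := hy₀
      obtain ⟨hD₀, heE₀, heD₀, hxE₀, hxcl₀⟩ := hDommem y₀ hy₀D
      have hDF₀ : y₀.1 ∈ F4 := by rw [hF4, Set.Finite.mem_toFinset]; exact hD₀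
      have hxD₀ : y₀.2.2 ∉ y₀.1 := fun h => hxcl₀ (M.subset_closure _ hD₀.1.subset_ground h)
      have heDf₀ : y₀.2.1 ∈ Df y₀.1 := by
        simp only [hDf, Finset.mem_filter, hmemE]
        exact ⟨heE₀, heD₀⟩
      have hxDf₀ : y₀.2.2 ∉ (Df y₀.1).erase y₀.2.1 := by
        intro h
        have h' := Finset.mem_of_mem_erase h
        simp only [hDf, Finset.mem_filter] at h'
        exact hxD₀ h'.2
      have hQ4 : Q.card = 4 := by
        have h1 := congrArg Sigma.fst hfy₀
        simp only [f] at h1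
        rw [← h1, Finset.card_insert_of_notMem hxDf₀, Finset.card_erase_of_mem heDf₀, hDfcard _ hDF₀]
      refine (Finset.card_le_card_of_injOn (fun y => y.2.2) ?_ ?_).trans (le_of_eq hQ4)
      · intro y hy
        rw [Finset.mem_coe, Finset.mem_filter] at hy
        obtain ⟨-, hfy⟩ := hy
        have h1 := congrArg Sigma.fst hfy
        simp only [f] at h1
        rw [Finset.mem_coe, ← h1]
        exact Finset.mem_insert_self _ _
      · intro y hy y' hy' hxx
        rw [Finset.mem_coe, Finset.mem_filter] at hy hy'
        obtain ⟨hyD, hfy⟩ := hy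
        obtain ⟨hy'D, hfy'⟩ := hy'
        obtain ⟨hD, heE, heD, hxE, hxcl⟩ := hDommem y hyD
        obtain ⟨hD', heE', heD', hxE', hxcl'⟩ := hDommem y' hy'D
        have hDF : y.1 ∈ F4 := by rw [hF4, Set.Finite.mem_toFinset]; exact hD
        have hDF' : y'.1 ∈ F4 := by rw [hF4, Set.Finite.mem_toFinset]; exact hD'
        have h1 := congrArg Sigma.fst hfy
        have h2 := congrArg Sigma.snd hfy
        have h1' := congrArg Sigma.fst hfy'
        have h2' := congrArg Sigma.snd hfy'
        simp only [f] at h1 h2 h1' h2' hxx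
        -- `D ∖ e = Q.erase x`, so the four-circuits coincide
        have hxD : y.2.2 ∉ y.1 := fun h => hxcl (M.subset_closure _ hD.1.subset_ground h)
        have hxD' : y'.2.2 ∉ y'.1 := fun h => hxcl' (M.subset_closure _ hD'.1.subset_ground h)
        have hDeq : y.1 = y'.1 := by
          have hcoe := hDfcoe _ hDF
          have hcoe' := hDfcoe _ hDF'
          have e1 : (Df y.1).erase y.2.1 = Q.erase y.2.2 := by
            rw [← h1, Finset.erase_insert]
            intro h
            have h' := Finset.mem_of_mem_erase h
            simp only [hDf, Finset.mem_filter] at h'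
            exact hxD h'.2
          have e2 : (Df y'.1).erase y'.2.1 = Q.erase y'.2.2 := by
            rw [← h1', Finset.erase_insert]
            intro h
            have h' := Finset.mem_of_mem_erase h
            simp only [hDf, Finset.mem_filter] at h'
            exact hxD' h'.2
          have heDf : y.2.1 ∈ Df y.1 := by
            simp only [hDf, Finset.mem_filter, hmemE]
            exact ⟨heE, heD⟩
          have heDf' : y'.2.1 ∈ Df y'.1 := by
            simp only [hDf, Finset.mem_filter, hmemE]
            exact ⟨heE', heD'⟩
          have e3 : Df y.1 = Df y'.1 := by
            rw [← Finset.insert_erase heDf, ← Finset.insert_erase heDf', e1, e2, hxx, h2, h2']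
          rw [← hcoe, ← hcoe', e3]
        obtain ⟨Dy, ey, xy⟩ := y
        obtain ⟨Dy', ey', xy'⟩ := y'
        simp only at hDeq h2 h2' hxx
        subst hDeq
        have hee : ey = ey' := by rw [h2, h2']
        subst hee
        subst hxx
        rfl
    · rw [Finset.not_nonempty_iff_eq_empty] at hne
      rw [hne, Finset.card_empty]
      exact Nat.zero_le _
  have hle := Finset.card_le_mul_card_image Dom 4 hfib
  have hPairs' : (Dom.image f).card ≤ Pairs.card := Finset.card_le_card himage
  rw [← hPairscard]
  omega

/-- **LEMMA X⁺⁺**: under (C1), (C2), (C3),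
`20·s₅ + 6·s₃·C(n−3, 2) + 16·(n−3)·s₃ + (16 + 4·(n − 6))·s₄ ≤ 24·C(n, 4)`. -/
theorem twenty_mul_ncard_fiveCircuits_add_add_le (M : Matroid α) [M.Finite]
    (hC1 : ∀ L ⊆ M.E, M.eRk L = 2 → L.ncard ≤ 3) (hC2 : ∀ P ⊆ M.E, M.eRk P ≤ 3 → P.ncard ≤ 6)
    (hC3 : ∀ X ⊆ M.E, M.eRk X ≤ 4 → X.ncard ≤ 10) :
    20 * (fiveCircuits M).ncard + 6 * (ThmN.triangles M).ncard * (M.E.ncard - 3).choose 2 +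
        16 * (M.E.ncard - 3) * (ThmN.triangles M).ncard +
        (16 + 4 * (M.E.ncard - 6)) * (fourCircuits M).ncard ≤
      24 * M.E.ncard.choose 4 := by
  classical
  have hEcard : M.ground_finite.toFinset.card = M.E.ncard := (Set.ncard_eq_toFinset_card _ _).symm
  have hF5 : (fiveCircuits M).ncard = (finite_fiveCircuits M).toFinset.card := Set.ncard_eq_toFinset_card _ _
  have hF4 : (fourCircuits M).ncard = (finite_fourCircuits M).toFinset.card := Set.ncard_eq_toFinset_card _ _
  have hF3 : (ThmN.triangles M).ncard = (finite_triangles M).toFinset.card := Set.ncard_eq_toFinset_card _ _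
  have hsum : ∑ Q ∈ M.ground_finite.toFinset.powersetCard 4,
      ((fifth M Q).card + (excl M Q).card +
        ((if M.Indep ((Q : Finset α) : Set α) then (excl2 M Q).card else 0) +
          4 * (if M.Indep ((Q : Finset α) : Set α) then 0 else 1))) ≤
      ∑ _Q ∈ M.ground_finite.toFinset.powersetCard 4, 6 := by
    apply Finset.sum_le_sum
    intro Q hQ
    have h := card_fifth_add_card_excl_add_le M hC2 hC3 hQ
    split_ifs at h ⊢ <;> omega
  rw [Finset.sum_add_distrib, Finset.sum_add_distrib, Finset.sum_add_distrib, sum_card_fifth,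
    ← Finset.mul_sum, Finset.sum_const, smul_eq_mul, Finset.card_powersetCard, hEcard] at hsum
  have h3 := three_mul_card_mul_choose_le_two_mul_sum_card_excl M hC1
  have h4 := card_add_mul_card_le_sum_dep M hC1
  have h5 := mul_card_le_sum_card_excl2 M hC2
  rw [hF5, hF4, hF3]
  nlinarith [hsum, h3, h4, h5]

/-- **LEMMA X⁺⁺ on the `e`-free core**, in the set-builder vocabulary of `S1RowTwelve`. -/
theorem core_twenty_mul_ncard_fiveCircuits_add_add_le (M : Matroid α) [M.Finite]
    (hfree : ∀ e ∈ M.E, ∃ A ⊆ M.E \ {e}, e ∉ M.closure A ∧ e ∉ M.closure ((M.E \ {e}) \ A)) :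
    20 * {C : Set α | M.IsCircuit C ∧ C.ncard = 5}.ncard +
        6 * {C : Set α | M.IsCircuit C ∧ C.ncard = 3}.ncard * (M.E.ncard - 3).choose 2 +
        16 * (M.E.ncard - 3) * {C : Set α | M.IsCircuit C ∧ C.ncard = 3}.ncard +
        (16 + 4 * (M.E.ncard - 6)) * {C : Set α | M.IsCircuit C ∧ C.ncard = 4}.ncard ≤
      24 * M.E.ncard.choose 4 := by
  have hL : ∀ e ∈ M.E, ¬ M.IsLoop e := ThmN.not_isLoop_of_free M hfree
  have hline : ∀ L ⊆ M.E, M.eRk L = 2 → L.ncard ≤ 3 := by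
    intro L hL' hr
    have := ThmN.ncard_add_one_le_two_pow_of_eRk_le M hL hfree 2 L hL' hr.le
    omega
  have hplane : ∀ P ⊆ M.E, M.eRk P ≤ 3 → P.ncard ≤ 6 := fun P hP hr =>
    ThmN.ncard_le_six_of_eRk_le_three_of_free M hfree hP hr
  have hten : ∀ X ⊆ M.E, M.eRk X ≤ 4 → X.ncard ≤ 10 := fun X hX hr =>
    ThmN.ncard_le_ten_of_eRk_le_four_of_free M hfree hX hr
  exact twenty_mul_ncard_fiveCircuits_add_add_le M hline hplane hten

end S1

end PercRepro
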